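import Summits.CriticalPhenomena.SAWScalingLimit.Theorems.SAWSpinMonotoneQCIdentificationXiForm

/-!
# Smirnov's primitive `Ξ = F^{8/5} dz`, III: exact boundary phases (helper sub-goal (O) of
`stub_rayCondition`, line `eight_fifths_primitive`, crux `QCIdentification`, stmt-CriticalPhenomena-16772)

**Setting.** As in `…XiLift`, `…XiForm`: `Λ` simply connected, boundary source `a = {u_a, v_a}`,
`F = Fobs Λ a`, `S_v = modeSum F v`, `a′_v = P85.bratio F v`, `A_k(v) = 1 + ω^k a′_v` the port
factors (`F(p_k) = (S_v/3) A_k(v)`, `P85.p85_port_factor`), `Θ` the lifted argument of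
`xi_exists_argLift` (`Θ_w - Θ_v = arg (S_w/S_v)` across adjacent faces of the source component
`Λ₀ = NB.srcComp Λ v_a`, `Θ_v ≡ arg S_v`, `Θ_{v_a} = arg S_{v_a}`), `W(p) = NB.bdryWinding Λ a p` the
rigid boundary winding (`W(a) = 0`).

**What.**

* (`pfac_eq_portFactor`, `qfac_eq_portFactor`) the corner factors `P_l`, `Q_l` of the hexagon file
  `…NoBranchingHexagonAux` ARE port factors: `P_l = A_{k_l+1}(v_l)`, `Q_l = A_{k_l}(v_l)`
  (`v_l = face s l`, `k_l = cornerIdx l`); hence the EXACT corner angle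
  `cornerAngle F v_l k_l = π/3 + arg A_{k_l}(v_l) - arg A_{k_l+1}(v_l)` (`cornerAngle_eq_portArg_sub`);
* the **lifted port argument** `portArg F Θ v k = Θ_v + arg A_k(v)` (a real lift of `arg F(p_k)`)
  is shared by the two ports of a common mid-edge (`portArg_shared`), so the corner excesses
  TELESCOPE along an arc of faces of `Λ₀` around a boundary site:
  `Σ_{arc} (cornerAngle - π/3) = portArg(p_in) - portArg(p_out)` EXACTLY (`arc_excess_eq_portArg_sub`);
* with the exact arc Gauss–Bonnet identity `NB.gb_arc_corner_sum_exact`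
  (`Σ_{arc} (cornerAngle - π/3) = (5/8)(W(p_out) - W(p_in))`) the **boundary phase**
  `bdPhase = portArg + (5/8) W` takes the SAME value on the two flank ports of every arc (registered
  `xi_phase_step`); it is an integer multiple of `2π` at every boundary port (registered
  `xi_bdPhase_int`: `portArg ≡ arg F(p) ≡ -(5/8)W(p)`), and it VANISHES at the source port
  (registered `xi_bdPhase_source`: `|arg S_{v_a} + arg A| < 3π/2`).

Consequently `bdPhase = 0` on every boundary port of the boundary cycle of `K_{Λ₀}` through `a`
(iterate `xi_phase_step` from the source), which puts the increments of `Ξ` there on ONE ray (sibling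
file `…XiRay`, `xi_boundary_one_ray`). Validated by exact enumeration
(`work/stubs/scratch_xi/xi_check.py`: 83 domains/sources, 828 boundary ports, `P = A`, `Q = A`,
telescoping and `bdPhase = 0` to machine precision).

Sources: S. Smirnov, *Towards conformal invariance of 2D lattice models*, Proc. ICM 2006
(arXiv:0708.0032) §5.6; H. Duminil-Copin, S. Smirnov, Ann. of Math. 175 (2012) 1653–1665
(arXiv:1007.0575), Lemma 1 and §3; stub report `STUB-REPORT-rayCondition.md` ((O)) of this line.
-/

noncomputable section

open Complex
open Literature.Probability.LatticeModels Literature.Probability.RandomPlanarGeometry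
open Literature.Probability.RandomPlanarGeometry.SAW
open Literature.Barriers.CriticalPhenomena Literature.Barriers.CriticalPhenomena.HexKernel
open Summit.CriticalPhenomena.SAWScalingLimit.Theses.SAWDevelopingMap

namespace Summit.CriticalPhenomena.SAWScalingLimit.Cruxes.QCIdentification.EightFifthsPrimitive

namespace Xi

open NB Dev P85 Stokes

variable {Λ : Finset HexVertex} {a : Sym2 HexVertex} {x : Site 2}

/-! ### The corner factors are port factors -/

/-- The constant of the outgoing corner dart: `cα · e_j = c₀(v_j) ω^{k_j+1} / 3`. -/
theorem cAlpha_mul_spoke (x : Site 2) (j : Fin 6) :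
    cAlpha * spoke j = dartCoeff (face x j) * omg ^ (((cornerIdx j + 1 : Fin 3)) : ℕ) / 3 := by
  have hsp : spoke j = faceSign (face x j) * omg ^ ((((cornerIdx j + 1 : Fin 3)) : ℕ) + 1) := by
    rw [← edge_out_eq_spoke x j, edge_eq]
  rw [hsp, dartCoeff_eq, cAlpha, pow_succ]
  linear_combination (faceSign (face x j) * (1 + triZeta) *
    omg ^ (((cornerIdx j + 1 : Fin 3)) : ℕ) / 18) * omg_pow_three

/-- The constant of the incoming corner dart: `cα · e_{j+1} = -c₀(v_j) ω^{k_j} / 3`. -/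
theorem cAlpha_mul_spoke_succ (x : Site 2) (j : Fin 6) :
    cAlpha * spoke (j + 1) = -(dartCoeff (face x j) * omg ^ ((cornerIdx j : ℕ)) / 3) := by
  have h := edge_in_eq_neg_spoke x j
  rw [edge_eq] at h
  have hsp : spoke (j + 1) = -(faceSign (face x j) * omg ^ ((cornerIdx j : ℕ) + 1)) := by
    linear_combination h
  rw [hsp, dartCoeff_eq, cAlpha, pow_succ]
  linear_combination (-(faceSign (face x j) * (1 + triZeta) *
    omg ^ ((cornerIdx j : ℕ)) / 18)) * omg_pow_three

/-- **`P_j = A_{k_j+1}(v_j)`**: the first corner factor of `face x j` at `x` is the port factor of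
its port `cornerIdx j + 1` (towards `face x (j-1)`). -/
theorem pfac_eq_portFactor (hΛ : hexDomainSimplyConnected Λ) (ha : a ∈ hexDomainBoundary Λ)
    (j : Fin 6) (hv : face x j ∈ Λ) (hS : modeSum (Fobs Λ a) (face x j) ≠ 0) :
    pfac (Fobs Λ a) x j =
      1 + omg ^ (((cornerIdx j + 1 : Fin 3)) : ℕ) * bratio (Fobs Λ a) (face x j) := by
  have h1 := dart_out_eq hΛ ha j hv hS
  rw [dart_eq, p85_port_factor Λ hΛ ha hv hS (cornerIdx j + 1), alpha] at h1
  have hc : cAlpha * modeSum (Fobs Λ a) (face x j) * spoke j ≠ 0 :=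
    mul_ne_zero (mul_ne_zero cAlpha_ne_zero hS) (spoke_ne_zero j)
  refine mul_left_cancel₀ hc ?_
  rw [← h1]
  have key := cAlpha_mul_spoke x j
  linear_combination (-(modeSum (Fobs Λ a) (face x j) *
    (1 + omg ^ (((cornerIdx j + 1 : Fin 3)) : ℕ) * bratio (Fobs Λ a) (face x j)))) * key

/-- **`Q_j = A_{k_j}(v_j)`**: the second corner factor of `face x j` at `x` is the port factor of
its port `cornerIdx j` (towards `face x (j+1)`). -/
theorem qfac_eq_portFactor (hΛ : hexDomainSimplyConnected Λ) (ha : a ∈ hexDomainBoundary Λ)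
    (j : Fin 6) (hv : face x j ∈ Λ) (hS : modeSum (Fobs Λ a) (face x j) ≠ 0) :
    qfac (Fobs Λ a) x j = 1 + omg ^ ((cornerIdx j : ℕ)) * bratio (Fobs Λ a) (face x j) := by
  have h1 := dart_in_eq hΛ ha j hv hS
  rw [dart_eq, p85_port_factor Λ hΛ ha hv hS (cornerIdx j), alpha] at h1
  have hc : cAlpha * modeSum (Fobs Λ a) (face x j) * spoke (j + 1) ≠ 0 :=
    mul_ne_zero (mul_ne_zero cAlpha_ne_zero hS) (spoke_ne_zero (j + 1))
  refine mul_left_cancel₀ hc ?_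
  have key := cAlpha_mul_spoke_succ x j
  linear_combination h1 - (modeSum (Fobs Λ a) (face x j) *
    (1 + omg ^ ((cornerIdx j : ℕ)) * bratio (Fobs Λ a) (face x j))) * key

/-! ### The lifted port argument -/

/-- The **lifted argument of `F` at the port `k` of `v`**: `Θ_v + arg (1 + ω^k a′_v)`, a real lift
of `arg F(p_k) = arg ((S_v/3)(1 + ω^k a′_v))` on the branch through `Θ`. -/
def portArg (F : Sym2 HexVertex → ℂ) (Θ : HexVertex → ℝ) (v : HexVertex) (k : Fin 3) : ℝ :=
  Θ v + arg (1 + omg ^ (k : ℕ) * bratio F v)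

/-- **The exact corner angle in port language**: under `NoFoldBound`,
`cornerAngle F (face x j) (cornerIdx j) = π/3 + portArg(port k_j) - portArg(port k_j + 1)`. -/
theorem cornerAngle_eq_portArg_sub (hK : NoFoldBound) (hΛ : hexDomainSimplyConnected Λ)
    (ha : a ∈ hexDomainBoundary Λ) (Θ : HexVertex → ℝ) (j : Fin 6) (hv : face x j ∈ Λ)
    (hS : modeSum (Fobs Λ a) (face x j) ≠ 0) :
    cornerAngle (Fobs Λ a) (face x j) (cornerIdx j) = Real.pi / 3 +
      portArg (Fobs Λ a) Θ (face x j) (cornerIdx j) -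
        portArg (Fobs Λ a) Θ (face x j) (cornerIdx j + 1) := by
  rw [cornerAngle_face_eq hK hΛ ha j hv hS, qfac_eq_portFactor hΛ ha j hv hS,
    pfac_eq_portFactor hΛ ha j hv hS, portArg, portArg]
  ring

/-- **The lifted port argument is shared across a mid-edge.** If `w = hexNbr v k ∈ Λ`, both modes
are non-zero and `Θ_w - Θ_v = arg (S_w/S_v)`, then `portArg F Θ w k = portArg F Θ v k`: the common
port value `F{v, w} = (S_v/3)A_v = (S_w/3)A_w` has `arg (S_w/S_v) = arg A_v - arg A_w` exactly. -/
theorem portArg_shared (hK : NoFoldBound) (hΛ : hexDomainSimplyConnected Λ)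
    (ha : a ∈ hexDomainBoundary Λ) (Θ : HexVertex → ℝ) {v : HexVertex} (k : Fin 3) (hv : v ∈ Λ)
    (hw : hexNbr v k ∈ Λ) (hSv : modeSum (Fobs Λ a) v ≠ 0)
    (hSw : modeSum (Fobs Λ a) (hexNbr v k) ≠ 0)
    (hΘ : Θ (hexNbr v k) - Θ v = arg (modeSum (Fobs Λ a) (hexNbr v k) / modeSum (Fobs Λ a) v)) :
    portArg (Fobs Λ a) Θ (hexNbr v k) k = portArg (Fobs Λ a) Θ v k := by
  set w := hexNbr v k with hwdef
  set Av := 1 + omg ^ (k : ℕ) * bratio (Fobs Λ a) v with hAv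
  set Aw := 1 + omg ^ (k : ℕ) * bratio (Fobs Λ a) w with hAw
  have hvA : 0 < Av.re := one_add_omg_pow_mul_re_pos (p85_norm_bratio_lt_one hK hΛ ha hv hSv) k
  have hwA : 0 < Aw.re := one_add_omg_pow_mul_re_pos (p85_norm_bratio_lt_one hK hΛ ha hw hSw) k
  have hwA0 : Aw ≠ 0 := Complex.ne_zero_of_re_pos hwA
  have hpv := p85_port_factor Λ hΛ ha hv hSv k
  have hpw := p85_port_factor Λ hΛ ha hw hSw k
  rw [show s(w, hexNbr w k) = s(v, hexNbr v k) by rw [hwdef, hexNbr_hexNbr, Sym2.eq_swap]] at hpw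
  have hprod : modeSum (Fobs Λ a) w * Aw = modeSum (Fobs Λ a) v * Av := by
    have h := hpv.symm.trans hpw
    rw [hAv, hAw]
    linear_combination (-3 : ℂ) * h
  have hdiv : modeSum (Fobs Λ a) w / modeSum (Fobs Λ a) v = Av / Aw := by
    rw [div_eq_div_iff hSv hwA0, hprod, mul_comm]
  rw [hdiv, arg_div_of_re_pos hvA hwA] at hΘ
  simp only [portArg, ← hAv, ← hAw]
  linarith

/-! ### Telescoping along an arc -/

/-- Consecutive corner indices around a site: `arcCornerIdx (l + 1) + 1 = arcCornerIdx l`. -/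
theorem arcCornerIdx_succ_add_one (l : Fin 6) : arcCornerIdx (l + 1) + 1 = arcCornerIdx l := by
  fin_cases l <;> rfl

variable {ua va : HexVertex}

/-- **Telescoping of the corner excesses along an arc of the source component** (indexed by `ℕ`
through `HV.fin6`): for `n + 1` consecutive faces `face s (j+1+t)`, `t ≤ n`, of `Λ₀`, the excesses
`cornerAngle - π/3` sum to `portArg` at the last port towards `face s (j+2+n)` minus `portArg` at
the first port towards `face s j`. -/
theorem arc_excess_telescope (hK : NoFoldBound) (hΛ : hexDomainSimplyConnected Λ)
    (hva : va ∈ Λ) (hua : ua ∉ Λ) (hadj : hexGraph.Adj va ua) (Θ : HexVertex → ℝ)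
    (hΘ : ∀ v ∈ srcComp Λ va, ∀ w ∈ srcComp Λ va, hexGraph.Adj v w →
      Θ w - Θ v = arg (modeSum (Fobs Λ s(ua, va)) w / modeSum (Fobs Λ s(ua, va)) v))
    (s : Site 2) (j : Fin 6) : ∀ n : ℕ, (∀ t, t ≤ n → face s (j + 1 + HV.fin6 t) ∈ srcComp Λ va) →
    ∑ t ∈ Finset.range (n + 1),
        (cornerAngle (Fobs Λ s(ua, va)) (face s (j + 1 + HV.fin6 t)) (arcCornerIdx (j + 1 + HV.fin6 t)) -
          Real.pi / 3) =
      portArg (Fobs Λ s(ua, va)) Θ (face s (j + 1 + HV.fin6 n)) (arcCornerIdx (j + 1 + HV.fin6 n)) -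
        portArg (Fobs Λ s(ua, va)) Θ (face s (j + 1)) (arcCornerIdx (j + 1) + 1) := by
  have ha : s(ua, va) ∈ hexDomainBoundary Λ := mk_mem_boundary hva hua hadj
  have hc : ∀ l : Fin 6, face s l ∈ srcComp Λ va →
      cornerAngle (Fobs Λ s(ua, va)) (face s l) (arcCornerIdx l) - Real.pi / 3 =
        portArg (Fobs Λ s(ua, va)) Θ (face s l) (arcCornerIdx l) -
          portArg (Fobs Λ s(ua, va)) Θ (face s l) (arcCornerIdx l + 1) := by
    intro l hl
    rw [arcCornerIdx_eq_cornerIdx, cornerAngle_eq_portArg_sub hK hΛ ha Θ l (srcComp_subset hl)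
      (modeSum_ne_zero_of_mem_srcComp hK hΛ hua hadj hl)]
    ring
  intro n
  induction n with
  | zero =>
    intro h
    have h0 := hc (j + 1) (by simpa using h 0 le_rfl)
    simpa using h0
  | succ n ih =>
    intro h
    rw [Finset.sum_range_succ, ih (fun t ht => h t (Nat.le_succ_of_le ht)),
      hc _ (h (n + 1) le_rfl)]
    -- the shared port between the faces `j+1+n` and `j+2+n`
    have e : j + 1 + HV.fin6 (n + 1) = j + 1 + HV.fin6 n + 1 := by rw [HV.fin6_succ]; abel
    have hl := h n (Nat.le_succ n)
    have hl' := h (n + 1) le_rfl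
    rw [e] at hl' ⊢
    set l := j + 1 + HV.fin6 n with hldef
    have hnb : hexNbr (face s l) (arcCornerIdx l) = face s (l + 1) := hexNbr_face_arcCornerIdx s l
    have hsh := portArg_shared hK hΛ ha Θ (arcCornerIdx l) (srcComp_subset hl)
      (hnb ▸ srcComp_subset hl') (modeSum_ne_zero_of_mem_srcComp hK hΛ hua hadj hl)
      (hnb ▸ modeSum_ne_zero_of_mem_srcComp hK hΛ hua hadj hl')
      (by rw [hnb]; exact hΘ _ hl _ hl' (hnb ▸ adj_hexNbr (face s l) (arcCornerIdx l)))
    rw [hnb] at hsh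
    rw [arcCornerIdx_succ_add_one l, hsh]
    ring

/-- **The arc excess is an exact difference of lifted port arguments.** For an arc
`face s (j+1), …, face s (j+m)` (`m ≠ 0`) of faces of the source component, the corner excesses
at `s` sum to `portArg(p_in) - portArg(p_out)`, `p_in` the port of `face s (j+m)` towards
`face s (j+1+m)`, `p_out` the port of `face s (j+1)` towards `face s j`. -/
theorem arc_excess_eq_portArg_sub (hK : NoFoldBound) (hΛ : hexDomainSimplyConnected Λ)
    (hva : va ∈ Λ) (hua : ua ∉ Λ) (hadj : hexGraph.Adj va ua) (Θ : HexVertex → ℝ)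
    (hΘ : ∀ v ∈ srcComp Λ va, ∀ w ∈ srcComp Λ va, hexGraph.Adj v w →
      Θ w - Θ v = arg (modeSum (Fobs Λ s(ua, va)) w / modeSum (Fobs Λ s(ua, va)) v))
    (s : Site 2) (j m : Fin 6) (hm : m ≠ 0)
    (hin : ∀ i : Fin 6, i < m → face s (j + 1 + i) ∈ srcComp Λ va) :
    ∑ i ∈ Finset.univ.filter (fun i : Fin 6 => i < m),
        (cornerAngle (Fobs Λ s(ua, va)) (face s (j + 1 + i)) (arcCornerIdx (j + 1 + i)) - Real.pi / 3) =
      portArg (Fobs Λ s(ua, va)) Θ (face s (j + m)) (arcCornerIdx (j + m)) -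
        portArg (Fobs Λ s(ua, va)) Θ (face s (j + 1)) (arcCornerIdx (j + 1) + 1) := by
  have hm0 : (m : ℕ) ≠ 0 := fun h => hm (Fin.ext h)
  obtain ⟨n, hn4, hmn⟩ : ∃ n : ℕ, n ≤ 4 ∧ (m : ℕ) = n + 1 := ⟨(m : ℕ) - 1, by omega, by omega⟩
  have em : HV.fin6 (n + 1) = m := Fin.ext (by rw [StepLaw.val_fin6_of_lt (by omega), hmn])
  have harc : ∀ t, t ≤ n → face s (j + 1 + HV.fin6 t) ∈ srcComp Λ va := by
    intro t ht
    apply hin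
    rw [Fin.lt_def, StepLaw.val_fin6_of_lt (by omega), hmn]
    omega
  have e2 : j + 1 + HV.fin6 n = j + m := by rw [← em, HV.fin6_succ]; abel
  rw [s4_sum_filter_lt_eq, hmn, arc_excess_telescope hK hΛ hva hua hadj Θ hΘ s j n harc, e2]

/-! ### The boundary phase -/

/-- The **boundary phase** of the port `k` of `v`: the lifted port argument plus `5/8` of the rigid
boundary winding of the port mid-edge `{hexNbr v k, v}` — an integer multiple of `2π` at boundary
ports (`xi_bdPhase_int`), the same on both flanks of every arc (`xi_phase_step`). -/
def bdPhase (Λ : Finset HexVertex) (a : Sym2 HexVertex) (Θ : HexVertex → ℝ) (v : HexVertex)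
    (k : Fin 3) : ℝ :=
  portArg (Fobs Λ a) Θ v k + 5 / 8 * bdryWinding Λ a s(hexNbr v k, v)

/-- **The phase step across an arc vanishes (registered).** Under `NoFoldBound`, for a simply
connected `Λ` with boundary source `{ua, va}` and `Θ` with the increments `arg (S_w/S_v)` across
adjacent faces of the source component `Λ₀ = NB.srcComp Λ va`: for every arc
`face s (j+1), …, face s (j+m)` (`m ≠ 0`) of faces of `Λ` with non-zero `∂H`-modes around a site
`s`, both flanks `face s j`, `face s (j+1+m)` outside `Λ`, the boundary phases of its two flank
ports — the port of `face s (j+1)` towards `face s j` and the port of `face s (j+m)` towards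
`face s (j+1+m)` — are EQUAL. -/
theorem xi_phase_step : NoFoldBound → ∀ {Λ : Finset HexVertex}, hexDomainSimplyConnected Λ → ∀ {ua va : HexVertex}, va ∈ Λ → ua ∉ Λ → hexGraph.Adj va ua → ∀ (Θ : HexVertex → ℝ), (∀ v ∈ NB.srcComp Λ va, ∀ w ∈ NB.srcComp Λ va, hexGraph.Adj v w → Θ w - Θ v = Complex.arg (modeSum (Fobs Λ s(ua, va)) w / modeSum (Fobs Λ s(ua, va)) v)) → ∀ (s : Site 2) (j m : Fin 6), m ≠ 0 → HexKernel.face s j ∉ Λ → (∀ i : Fin 6, i < m → HexKernel.face s (j + 1 + i) ∈ Λ) → HexKernel.face s (j + 1 + m) ∉ Λ → (∀ i : Fin 6, i < m → modeSum (Fobs Λ s(ua, va)) (HexKernel.face s (j + 1 + i)) ≠ 0) → Xi.bdPhase Λ s(ua, va) Θ (HexKernel.face s (j + 1)) (arcCornerIdx (j + 1) + 1) = Xi.bdPhase Λ s(ua, va) Θ (HexKernel.face s (j + m)) (arcCornerIdx (j + m)) := by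
  intro hK Λ hΛ ua va hva hua hadj Θ hΘ s j m hm hout hin hout' hS
  have ha : s(ua, va) ∈ hexDomainBoundary Λ := mk_mem_boundary hva hua hadj
  have hin0 : ∀ i : Fin 6, i < m → face s (j + 1 + i) ∈ srcComp Λ va :=
    fun i hi => mem_srcComp_of_modeSum_ne_zero hva hua (hin i hi) (hS i hi)
  have hgb := gb_arc_corner_sum_exact hK hΛ ha s j m hm hout hin hout' hS
  have htel := arc_excess_eq_portArg_sub hK hΛ hva hua hadj Θ hΘ s j m hm hin0
  rw [Finset.sum_sub_distrib, hgb, Finset.sum_const, card_filter_lt, nsmul_eq_mul] at htel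
  have h1 : hexNbr (face s (j + 1)) (arcCornerIdx (j + 1) + 1) = face s j := by
    rw [hexNbr_face_arcCornerIdx_succ, add_sub_cancel_right]
  have h2 : hexNbr (face s (j + m)) (arcCornerIdx (j + m)) = face s (j + 1 + m) := by
    rw [hexNbr_face_arcCornerIdx, show j + m + 1 = j + 1 + m by abel]
  rw [bdPhase, bdPhase, h1, h2]
  linarith

/-- **The boundary phase is an integer multiple of `2π` (registered).** Under `NoFoldBound`, at a
boundary port of a simply connected domain with boundary source (`v ∈ Λ`, `hexNbr v k ∉ Λ`,
`S_v ≠ 0`), for every `Θ` with `Θ_v ≡ arg S_v (mod 2π)`: `bdPhase Λ a Θ v k ∈ 2πℤ`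
(`portArg ≡ arg S_v + arg A = arg F(p) ≡ -(5/8) W(p)`). -/
theorem xi_bdPhase_int : NoFoldBound → ∀ {Λ : Finset HexVertex}, hexDomainSimplyConnected Λ → ∀ {a : Sym2 HexVertex}, a ∈ hexDomainBoundary Λ → ∀ (Θ : HexVertex → ℝ) {v : HexVertex} (k : Fin 3), v ∈ Λ → hexNbr v k ∉ Λ → modeSum (Fobs Λ a) v ≠ 0 → (Θ v : Real.Angle) = Complex.arg (modeSum (Fobs Λ a) v) → ∃ N : ℤ, Xi.bdPhase Λ a Θ v k = 2 * Real.pi * N := by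
  intro hK Λ hΛ a ha Θ v k hv hu hS hΘ
  set A := 1 + omg ^ (k : ℕ) * bratio (Fobs Λ a) v with hA
  have hA0 : A ≠ 0 :=
    Complex.ne_zero_of_re_pos (one_add_omg_pow_mul_re_pos (p85_norm_bratio_lt_one hK hΛ ha hv hS) k)
  have hp : s(hexNbr v k, v) ∈ hexDomainBoundary Λ := mk_mem_boundary hv hu (adj_hexNbr v k)
  have hF : Fobs Λ a s(hexNbr v k, v) ≠ 0 := by
    rw [Sym2.eq_swap]
    exact fobs_ne_zero_of_modeSum_ne_zero hK hΛ ha hv hS k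
  have hpf : Fobs Λ a s(hexNbr v k, v) = ((1 / 3 : ℝ) : ℂ) * (modeSum (Fobs Λ a) v * A) := by
    rw [Sym2.eq_swap, p85_port_factor Λ hΛ ha hv hS k]
    push_cast
    ring
  have hang : ((bdPhase Λ a Θ v k : ℝ) : Real.Angle) = ((0 : ℝ) : Real.Angle) := by
    have hw := arg_fobs_coe_bdryWinding hΛ ha hp hF
    rw [hpf, Complex.arg_real_mul _ (by norm_num : (0 : ℝ) < 1 / 3),
      Complex.arg_mul_coe_angle hS hA0] at hw
    have e : bdPhase Λ a Θ v k = Θ v + arg A + 5 / 8 * bdryWinding Λ a s(hexNbr v k, v) := rfl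
    rw [e, Real.Angle.coe_add, Real.Angle.coe_add, hΘ, hw, ← Real.Angle.coe_add,
      show -(5 / 8 : ℝ) * bdryWinding Λ a s(hexNbr v k, v) + 5 / 8 * bdryWinding Λ a s(hexNbr v k, v) = 0
        by ring]
  obtain ⟨N, hN⟩ := Real.Angle.angle_eq_iff_two_pi_dvd_sub.1 hang
  exact ⟨N, by linarith⟩

/-- **The boundary phase vanishes at the source port (registered).** Under `NoFoldBound`, for a
simply connected `Λ` with boundary source `{ua, va}` (`va ∈ Λ`, `ua ∉ Λ`, `hexNbr va k = ua`) and any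
`Θ` normalised by `Θ va = arg S_{va}`: `bdPhase Λ {ua, va} Θ va k = 0` (it lies in `2πℤ` and
`|arg S_{va} + arg A| < 3π/2`, `W(a) = 0`). -/
theorem xi_bdPhase_source : NoFoldBound → ∀ {Λ : Finset HexVertex}, hexDomainSimplyConnected Λ → ∀ {ua va : HexVertex}, va ∈ Λ → ua ∉ Λ → hexGraph.Adj va ua → ∀ (Θ : HexVertex → ℝ) (k : Fin 3), hexNbr va k = ua → Θ va = Complex.arg (modeSum (Fobs Λ s(ua, va)) va) → Xi.bdPhase Λ s(ua, va) Θ va k = 0 := by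
  intro hK Λ hΛ ua va hva hua hadj Θ k hk hΘ
  have ha : s(ua, va) ∈ hexDomainBoundary Λ := mk_mem_boundary hva hua hadj
  have hS := modeSum_source_ne_zero hK hΛ hva hua hadj
  obtain ⟨N, hN⟩ := xi_bdPhase_int hK hΛ ha Θ k hva (hk ▸ hua) hS (by rw [hΘ])
  have hA : 0 < (1 + omg ^ (k : ℕ) * bratio (Fobs Λ s(ua, va)) va).re :=
    one_add_omg_pow_mul_re_pos (p85_norm_bratio_lt_one hK hΛ ha hva hS) k
  have hAa := abs_lt.1 (Complex.abs_arg_lt_pi_div_two_iff.2 (Or.inl hA))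
  have hW : bdryWinding Λ s(ua, va) s(hexNbr va k, va) = 0 := by rw [hk, bdryWinding_self]
  have e : bdPhase Λ s(ua, va) Θ va k =
      arg (modeSum (Fobs Λ s(ua, va)) va) + arg (1 + omg ^ (k : ℕ) * bratio (Fobs Λ s(ua, va)) va) := by
    rw [bdPhase, portArg, hW, hΘ]
    ring
  have hlo := Complex.neg_pi_lt_arg (modeSum (Fobs Λ s(ua, va)) va)
  have hhi := Complex.arg_le_pi (modeSum (Fobs Λ s(ua, va)) va)
  have hπ := Real.pi_pos
  rw [e] at hN
  rw [e, hN]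
  -- `|2πN| < 3π/2` forces `N = 0`
  have h1 : (-1 : ℝ) < N := by
    by_contra hc
    have : 2 * Real.pi * N ≤ 2 * Real.pi * (-1) :=
      mul_le_mul_of_nonneg_left (not_lt.1 hc) (by positivity)
    linarith
  have h2 : (N : ℝ) < 1 := by
    by_contra hc
    have : 2 * Real.pi * 1 ≤ 2 * Real.pi * N :=
      mul_le_mul_of_nonneg_left (not_lt.1 hc) (by positivity)
    linarith
  have hN0 : N = 0 := by
    have h1' : (-1 : ℤ) < N := by exact_mod_cast h1
    have h2' : N < (1 : ℤ) := by exact_mod_cast h2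
    omega
  simp [hN0]

end Xi

end Summit.CriticalPhenomena.SAWScalingLimit.Cruxes.QCIdentification.EightFifthsPrimitive

end
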